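import Summits.QuantumFields.BalabanUV.T4Continuum.Support.NE7FlatGradientLetterCompact
import HarnessLib

/-!
# NE7FlatGradientModulusPrep — PREPARATION FOR THE FLAT C¹ COMPACT LETTER PART (ii) (the log-Lipschitz modulus of the gradient): the harmonic tail, the
# logarithmic shell sum `Σ_{a ≤ |z|_∞ ≤ R} nrm(z)^{−d} ≤ 2d·3^{d−1}·(1 + log⁺(R∕a))`, and the dipole kernel off the diagonal
# `|dG₀ μ (v + w) − dG₀ μ v| ≤ |w|₁·C₂·2^d·nrm(v)^{−d}` for `2|w|_∞ ≤ nrm v` (INTERFACE REQUEST NE7 stub (S-c), second half, bricks)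

Cell `pub-balaban`, rung (B)+1 sub-cell t4; written by the row-NE7b OWNER lineage `b2b-balaban-t4-ne7b-p1` (gen 154) for the sibling crux row NE7
(lineage `t4-ne7-p1`, gen 106's INTERFACE REQUEST NE7 stub (S-c), `HOME/INBOX.md` [NE7P1-G106-INBOX-2], memo `t4/b2b-balaban-t4-ne7-p1-g106/ROAD-G106.md` §4 (ii):
«the modulus companion `‖∇Z(x) − ∇Z(x′)‖ ≤ C·|x − x′|·(1 + log(M N′∕|x − x′|))·(same data)` (second differences of the kernel off the diagonal)»).  Sequel of
`NE7FlatGradientLetterCompact` (part (i)); consumed by `NE7FlatGradientModulusCompact` (part (ii)).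
THE BRICKS ([folklore] real analysis and discrete potential theory over pv23's `Beta/PoissonInterior`, KERNEL; 0 def, 0 sorry; every `d`, resp. `d ≥ 3` for §3).
§1 `inv_succ_le_log_sub` (`1∕(j+1) ≤ log(j+1) − log j`), `sum_Icc_inv_le_log` (HARMONIC TAIL `Σ_{j=a}^{b} 1∕j ≤ 1 + log b − log a`, `1 ≤ a ≤ b`),
   `posLog_three_halves_mul_le` (`log⁺(3t∕2) ≤ 1 + log⁺ t`).
§2 `sum_reflect_le` (re-indexing `y ↦ x − y` into a dominating finset), **`sum_cube_far_inv_nrm_pow_le`** (THE LOGARITHMIC SHELL SUM: with pv23's `card_shell_le`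
   (`#{|z|_∞ = j} ≤ 2d(2j+1)^{d−1}`) each shell `j ≥ a` weighs `≤ 2d·3^{d−1}∕j`, and the harmonic tail gives `Σ_{z ∈ cube 0 R, a ≤ |z|_∞} nrm(z)^{−d} ≤ 2d·3^{d−1}(1 + log⁺(R∕a))`).
§3 `half_nrm_le_nrm_add` (`2|s|_∞ ≤ nrm v ⟹ nrm v∕2 ≤ nrm(v + s)`), **`abs_dG₀_add_sub_le`** (KERNEL DIFFERENCES ALONG ℓ¹ PATHS: pv23's unit second differences
   `G₀_diff2_bound` (`|∇_i∇_μG₀(v)| ≤ C₂·nrm(v)^{−d}`) telescoped along a lattice path from `v` to `v + w` that lowers `|·|₁` by one at each step and never raises `|·|_∞`,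
   so every base point keeps half the norm: `|dG₀ μ (v + w) − dG₀ μ v| ≤ |w|₁ · C₂·2^d∕nrm(v)^d`; induction on `|w|₁`).
HONEST FRAMING (page 1): elementary lemmas; `U = 1`, flat, scalar kernel; nothing of Bałaban's; NOT NE7, nothing of row NE7b (`T4WeightBudget.RelWeightBound` NOT PRINTED ∕
NOT PROVED); spine count = dagwriter∕referees' call; finite T⁴ rung (B)+1 — NOT infinite volume, NOT mass gap, NOT BetaPertH, NOT Clay.  Continuum YM on T⁴ ⇐ BetaPertH ∧ nine
spine estimates (0/9 proved); BetaPertH ⇐ (D1) ∧ (D4) ∧ CAP+tail; G-an2-4 gates asym, D1 and NE2/3/4.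
-/

set_option autoImplicit false

open scoped BigOperators Matrix.Norms.L2Operator
open Finset

namespace Summit.QuantumFields.BalabanUV.T4Continuum.NE7FlatGradientModulusPrep

open Literature.MathematicalPhysics.QuantumFieldTheory.Balaban1983to89
open B7Prop1Explicit (Site e)
open T4AveragingDeficitWall (curlAt)
open BlockAveragePushDirSplit (flat)
open NE3CoercivityScaling (flatDiv)
open Literature.Probability.LatticeModels (latticeLaplacianZd)
open Beta.PoissonInterior (cube mem_cube cube_mono mem_cube_zero_iff supNorm supNorm_le_iff natAbs_le_supNorm supNorm_eq_zero_iff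
  supNorm_add_le supNorm_neg nrm nrm_pos one_le_nrm supNorm_le_nrm G₀ dG₀ G₀_diff_bound G₀_diff2_bound green_rep sum_cube_inv_nrm_pow_le
  card_shell_le)
open NE7FlatGradientLetterCompact (norm_lapVec_le lap_dual_apply mem_cube_succ_of_add_e gradient_letter_cube)

noncomputable section

variable {d : ℕ} {n : Type*} [Fintype n] [DecidableEq n]

/-! ## §1 Real lemmas: the harmonic tail and a `log⁺` inequality -/

omit [Fintype n] [DecidableEq n] in
/-- `1∕(j+1) ≤ log (j+1) − log j` (`j ≥ 1`). [folklore] -/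
theorem inv_succ_le_log_sub (j : ℕ) (hj : 1 ≤ j) : 1 / ((j : ℝ) + 1) ≤ Real.log ((j : ℝ) + 1) - Real.log j := by
  have hj0 : (0 : ℝ) < j := by exact_mod_cast hj
  have hj1 : (0 : ℝ) < (j : ℝ) + 1 := by positivity
  rw [← Real.log_div hj1.ne' hj0.ne']
  have h := Real.one_sub_inv_le_log_of_pos (x := ((j : ℝ) + 1) / j) (by positivity)
  rw [inv_div] at h
  have : 1 - (j : ℝ) / ((j : ℝ) + 1) = 1 / ((j : ℝ) + 1) := by field_simp; ring
  linarith

omit [Fintype n] [DecidableEq n] in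
/-- **HARMONIC TAIL**: `Σ_{j = a}^{b} 1∕j ≤ 1 + log b − log a` for `1 ≤ a ≤ b`. [folklore] -/
theorem sum_Icc_inv_le_log (a : ℕ) (ha : 1 ≤ a) (b : ℕ) (hab : a ≤ b) :
    ∑ j ∈ Finset.Icc a b, 1 / (j : ℝ) ≤ 1 + Real.log b - Real.log a := by
  induction b, hab using Nat.le_induction with
  | base =>
    rw [Finset.Icc_self, Finset.sum_singleton]
    have ha1 : (1 : ℝ) ≤ a := by exact_mod_cast ha
    have : 1 / (a : ℝ) ≤ 1 := by rw [div_le_one (by positivity)]; exact ha1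
    linarith
  | succ b hab ih =>
    rw [Finset.sum_Icc_succ_top (by omega : a ≤ b + 1)]
    have hb1 : 1 ≤ b := le_trans ha hab
    have h := inv_succ_le_log_sub b hb1
    push_cast
    linarith

omit [Fintype n] [DecidableEq n] in
/-- `log⁺ (3∕2 · t) ≤ 1 + log⁺ t` for `t ≥ 0`. [folklore] -/
theorem posLog_three_halves_mul_le {t : ℝ} (ht : 0 ≤ t) : Real.posLog (3 / 2 * t) ≤ 1 + Real.posLog t := by
  have h1 : Real.posLog (3 / 2 * t) ≤ Real.posLog (3 / 2) + Real.posLog t := Real.posLog_mul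
  have h2 : Real.posLog (3 / 2 : ℝ) ≤ 1 := by
    rw [Real.posLog_eq_log (by rw [abs_of_pos (by norm_num)]; norm_num)]
    have := Real.log_le_sub_one_of_pos (show (0 : ℝ) < 3 / 2 by norm_num)
    linarith
  have _ := ht
  linarith

/-! ## §2 Lattice sums: re-indexing and the logarithmic shell sum -/

omit [Fintype n] [DecidableEq n] in
/-- Re-indexing `y ↦ x − y`: if `x − T ⊆ S` then `Σ_{y ∈ T} φ(x − y) ≤ Σ_{z ∈ S} φ(z)` for `φ ≥ 0`. [folklore] -/
theorem sum_reflect_le (x : Site d) (T S : Finset (Site d)) (φ : Site d → ℝ) (hφ : ∀ z, 0 ≤ φ z)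
    (hTS : ∀ y ∈ T, x - y ∈ S) : ∑ y ∈ T, φ (x - y) ≤ ∑ z ∈ S, φ z := by
  have hinj : Set.InjOn (fun y : Site d => x - y) ↑T := fun a _ b _ h => sub_right_injective h
  rw [← Finset.sum_image (f := φ) hinj]
  refine Finset.sum_le_sum_of_subset_of_nonneg (fun z hz => ?_) fun z _ _ => hφ z
  rw [Finset.mem_image] at hz
  obtain ⟨y, hy, rfl⟩ := hz
  exact hTS y hy

omit [Fintype n] [DecidableEq n] in
/-- **THE LOGARITHMIC SHELL SUM**: `Σ_{z ∈ cube 0 R, a ≤ |z|_∞} nrm(z)^{−d} ≤ 2d·3^{d−1}·(1 + log⁺(R∕a))` for `a ≥ 1`. [folklore] -/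
theorem sum_cube_far_inv_nrm_pow_le (hd : 0 < d) (R a : ℕ) (ha : 1 ≤ a) :
    ∑ z ∈ (cube (0 : Site d) R).filter (fun z => a ≤ supNorm z), 1 / nrm z ^ d
      ≤ 2 * d * 3 ^ (d - 1) * (1 + Real.posLog ((R : ℝ) / a)) := by
  have hpos : (0 : ℝ) ≤ 2 * d * 3 ^ (d - 1) * (1 + Real.posLog ((R : ℝ) / a)) := by
    have := Real.posLog_nonneg (x := (R : ℝ) / a); positivity
  by_cases haR : a ≤ R
  swap
  · have hempty : (cube (0 : Site d) R).filter (fun z => a ≤ supNorm z) = ∅ := by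
      rw [Finset.filter_eq_empty_iff]
      intro z hz h
      have := mem_cube_zero_iff.1 hz
      omega
    rw [hempty, Finset.sum_empty]
    exact hpos
  have hmaps : ∀ z ∈ (cube (0 : Site d) R).filter (fun z => a ≤ supNorm z), supNorm z ∈ Finset.Icc a R := by
    intro z hz
    rw [Finset.mem_filter] at hz
    rw [Finset.mem_Icc]
    exact ⟨hz.2, mem_cube_zero_iff.1 hz.1⟩
  rw [← Finset.sum_fiberwise_of_maps_to hmaps]
  have hfib : ∀ j ∈ Finset.Icc a R,
      ∑ z ∈ ((cube (0 : Site d) R).filter (fun z => a ≤ supNorm z)).filter (fun z => supNorm z = j), 1 / nrm z ^ d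
        ≤ 2 * d * 3 ^ (d - 1) * (1 / (j : ℝ)) := by
    intro j hj
    rw [Finset.mem_Icc] at hj
    have hj1 : 1 ≤ j := le_trans ha hj.1
    have hj0 : (0 : ℝ) < j := by exact_mod_cast hj1
    have hj1r : (1 : ℝ) ≤ j := by exact_mod_cast hj1
    have hsub : ((cube (0 : Site d) R).filter (fun z => a ≤ supNorm z)).filter (fun z => supNorm z = j)
        ⊆ (cube (0 : Site d) R).filter (fun z => supNorm z = j) := by
      intro z hz
      simp only [Finset.mem_filter] at hz ⊢
      exact ⟨hz.1.1, hz.2⟩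
    have hval : ∀ z ∈ ((cube (0 : Site d) R).filter (fun z => a ≤ supNorm z)).filter (fun z => supNorm z = j),
        1 / nrm z ^ d = 1 / (j : ℝ) ^ d := by
      intro z hz
      simp only [Finset.mem_filter] at hz
      have : nrm z = j := by
        unfold nrm; rw [hz.2]; exact max_eq_right (by exact_mod_cast hj1)
      rw [this]
    rw [Finset.sum_congr rfl hval, Finset.sum_const, nsmul_eq_mul]
    have hcard : ((((cube (0 : Site d) R).filter (fun z => a ≤ supNorm z)).filter (fun z => supNorm z = j)).card : ℝ)
        ≤ 2 * d * (2 * j + 1) ^ (d - 1) :=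
      le_trans (by exact_mod_cast Finset.card_le_card hsub) (card_shell_le hd R j hj1)
    have hjd : (j : ℝ) ^ d = (j : ℝ) ^ (d - 1) * j := by
      rw [← pow_succ, Nat.sub_add_cancel (by omega : 1 ≤ d)]
    calc ((((cube (0 : Site d) R).filter (fun z => a ≤ supNorm z)).filter (fun z => supNorm z = j)).card : ℝ) * (1 / (j : ℝ) ^ d)
        ≤ 2 * d * (2 * j + 1) ^ (d - 1) * (1 / (j : ℝ) ^ d) := mul_le_mul_of_nonneg_right hcard (by positivity)
      _ ≤ 2 * d * (3 * (j : ℝ)) ^ (d - 1) * (1 / (j : ℝ) ^ d) := by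
          apply mul_le_mul_of_nonneg_right _ (by positivity)
          apply mul_le_mul_of_nonneg_left _ (by positivity)
          exact pow_le_pow_left₀ (by positivity) (by linarith) _
      _ = 2 * d * 3 ^ (d - 1) * (1 / (j : ℝ)) := by
          rw [mul_pow, hjd]
          field_simp
  have hRpos : (0 : ℝ) < R := by exact_mod_cast lt_of_lt_of_le (by omega : 0 < a) haR
  have ha0 : (0 : ℝ) < a := by exact_mod_cast (by omega : 0 < a)
  calc ∑ j ∈ Finset.Icc a R, ∑ z ∈ ((cube (0 : Site d) R).filter (fun z => a ≤ supNorm z)).filter (fun z => supNorm z = j), 1 / nrm z ^ d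
      ≤ ∑ j ∈ Finset.Icc a R, 2 * d * 3 ^ (d - 1) * (1 / (j : ℝ)) := Finset.sum_le_sum hfib
    _ = 2 * d * 3 ^ (d - 1) * ∑ j ∈ Finset.Icc a R, 1 / (j : ℝ) := by rw [Finset.mul_sum]
    _ ≤ 2 * d * 3 ^ (d - 1) * (1 + Real.log R - Real.log a) :=
        mul_le_mul_of_nonneg_left (sum_Icc_inv_le_log a ha R haR) (by positivity)
    _ ≤ 2 * d * 3 ^ (d - 1) * (1 + Real.posLog ((R : ℝ) / a)) := by
        apply mul_le_mul_of_nonneg_left _ (by positivity)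
        rw [add_sub_assoc, ← Real.log_div hRpos.ne' ha0.ne']
        exact add_le_add le_rfl (le_max_right _ _)

/-! ## §3 The dipole kernel off the diagonal: differences along ℓ¹ lattice paths -/

omit [Fintype n] [DecidableEq n] in
/-- A shift by at most half the norm keeps half the norm: `2|s|_∞ ≤ nrm v ⟹ nrm v ∕ 2 ≤ nrm (v + s)`. [folklore] -/
theorem half_nrm_le_nrm_add (v s : Site d) (h : 2 * (supNorm s : ℝ) ≤ nrm v) : nrm v / 2 ≤ nrm (v + s) := by
  have h1 : supNorm v ≤ supNorm (v + s) + supNorm s := by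
    simpa [supNorm_neg] using supNorm_add_le (v + s) (-s)
  have h1' : (supNorm v : ℝ) ≤ supNorm (v + s) + supNorm s := by exact_mod_cast h1
  unfold nrm at h ⊢
  rcases le_or_gt 1 (supNorm v : ℝ) with hv | hv
  · rw [max_eq_right hv] at h ⊢
    calc (supNorm v : ℝ) / 2 ≤ supNorm (v + s) := by linarith
      _ ≤ max 1 (supNorm (v + s) : ℝ) := le_max_right _ _
  · rw [max_eq_left hv.le] at h ⊢
    linarith [le_max_left (1 : ℝ) (supNorm (v + s) : ℝ)]

omit [Fintype n] [DecidableEq n] in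
/-- **KERNEL DIFFERENCES ALONG ℓ¹ PATHS**: `∃ C₂ ≥ 0` with `|dG₀ μ (v + w) − dG₀ μ v| ≤ |w|₁ · C₂·2^d ∕ nrm(v)^d` whenever `2|w|_∞ ≤ nrm v`
(`|w|₁ = Σ_i |w i|`; the unit second differences of `G₀_diff2_bound` telescoped along a lattice path from `v` to `v + w` all of whose points keep half the norm). [folklore] -/
theorem abs_dG₀_add_sub_le (hd : 3 ≤ d) : ∃ C₂ : ℝ, 0 ≤ C₂ ∧ ∀ (μ : Fin d) (m : ℕ) (v w : Site d),
    (∑ i, |w i| : ℤ) = m → 2 * (supNorm w : ℝ) ≤ nrm v →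
    |dG₀ μ (v + w) - dG₀ μ v| ≤ m * (C₂ * 2 ^ d / nrm v ^ d) := by
  obtain ⟨C₂, hC₂, hG2⟩ := G₀_diff2_bound hd
  refine ⟨C₂, hC₂, fun μ m => ?_⟩
  -- one unit step at any base point
  have hunit : ∀ (b : Site d) (i : Fin d), |dG₀ μ (b + e i) - dG₀ μ b| ≤ C₂ / nrm b ^ d := by
    intro b i
    have h := hG2 b μ i
    have : dG₀ μ (b + e i) - dG₀ μ b
        = G₀ (b + Pi.single i 1 + Pi.single μ 1) - G₀ (b + Pi.single i 1) - G₀ (b + Pi.single μ 1) + G₀ b := by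
      show G₀ (b + Pi.single i 1 + Pi.single μ 1) - G₀ (b + Pi.single i 1) - (G₀ (b + Pi.single μ 1) - G₀ b) = _
      ring
    rw [this]
    exact h
  -- half the norm gives a factor `2^d`
  have hhalf : ∀ (v b : Site d), nrm v / 2 ≤ nrm b → C₂ / nrm b ^ d ≤ C₂ * 2 ^ d / nrm v ^ d := by
    intro v b hb
    have hb0 := nrm_pos b
    have hv0 := nrm_pos v
    rw [div_le_div_iff₀ (pow_pos hb0 d) (pow_pos hv0 d)]
    calc C₂ * nrm v ^ d ≤ C₂ * (2 * nrm b) ^ d := by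
          apply mul_le_mul_of_nonneg_left _ hC₂
          exact pow_le_pow_left₀ hv0.le (by linarith) _
      _ = C₂ * 2 ^ d * nrm b ^ d := by rw [mul_pow]; ring
  induction m with
  | zero =>
    intro v w hw _
    have hw0 : w = 0 := by
      funext i
      have h0 := (Finset.sum_eq_zero_iff_of_nonneg (fun i _ => abs_nonneg (w i))).1 (by exact_mod_cast hw) i (Finset.mem_univ i)
      exact abs_eq_zero.1 h0
    subst hw0
    simp
  | succ m ih =>
    intro v w hw hsup
    have hex : ∃ i, w i ≠ 0 := by
      by_contra hall
      simp only [not_exists, not_not] at hall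
      have : (∑ i, |w i| : ℤ) = 0 := Finset.sum_eq_zero fun i _ => by rw [hall i, abs_zero]
      omega
    obtain ⟨i, hi⟩ := hex
    have he : ∀ j : Fin d, (e i : Site d) j = if j = i then 1 else 0 := fun j => by
      change (Pi.single i (1 : ℤ) : Site d) j = _
      rw [Pi.single_apply]
    -- the step toward zero along coordinate `i`: `w = w′ + σ e_i`, `|w′|₁ = m`, `|w′|_∞ ≤ |w|_∞`
    obtain ⟨σ, hσ, hσw⟩ : ∃ σ : ℤ, (σ = 1 ∨ σ = -1) ∧ |w i - σ| = |w i| - 1 := by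
      rcases lt_or_gt_of_ne hi with hneg | hpos
      · exact ⟨-1, Or.inr rfl, by rw [abs_of_neg hneg, sub_neg_eq_add, abs_of_nonpos (by omega)]; ring⟩
      · exact ⟨1, Or.inl rfl, by rw [abs_of_pos hpos, abs_of_nonneg (by omega)]⟩
    set w' : Site d := w - σ • e i with hw'def
    have hcoord : ∀ j, w' j = w j - σ * (if j = i then 1 else 0) := fun j => by
      simp only [hw'def, Pi.sub_apply, Pi.smul_apply, smul_eq_mul, he]
    have habs : ∀ j, |w' j| = |w j| + (if j = i then -1 else 0) := by
      intro j
      rw [hcoord j]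
      split_ifs with hj
      · subst hj; rw [mul_one, hσw]; ring
      · simp
    have hsum' : (∑ j, |w' j| : ℤ) = m := by
      simp_rw [habs]
      rw [Finset.sum_add_distrib, Finset.sum_ite_eq' Finset.univ i, if_pos (Finset.mem_univ _), hw]
      push_cast
      ring
    have hsup' : supNorm w' ≤ supNorm w := by
      rw [supNorm_le_iff]
      intro j
      have hwj := natAbs_le_supNorm w j
      have habsj := habs j
      split_ifs at habsj with hj
      · have : (w' j).natAbs + 1 = (w j).natAbs := by
          have h1 : ((w' j).natAbs : ℤ) = |w' j| := Int.natCast_natAbs (w' j)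
          have h2 : ((w j).natAbs : ℤ) = |w j| := Int.natCast_natAbs (w j)
          omega
        omega
      · have : (w' j).natAbs = (w j).natAbs := by
          have h1 : ((w' j).natAbs : ℤ) = |w' j| := Int.natCast_natAbs (w' j)
          have h2 : ((w j).natAbs : ℤ) = |w j| := Int.natCast_natAbs (w j)
          omega
        omega
    have hsupR : 2 * (supNorm w' : ℝ) ≤ nrm v :=
      le_trans (by exact_mod_cast Nat.mul_le_mul_left 2 hsup') hsup
    have h1 := ih v w' hsum' hsupR
    have hww' : w = w' + σ • e i := by rw [hw'def]; abel
    -- the unit step between `v + w′` and `v + w`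
    have h2 : |dG₀ μ (v + w) - dG₀ μ (v + w')| ≤ C₂ * 2 ^ d / nrm v ^ d := by
      rcases hσ with rfl | rfl
      · -- forward step at base `v + w′`
        have hb : nrm v / 2 ≤ nrm (v + w') := half_nrm_le_nrm_add v w' hsupR
        have : v + w = (v + w') + e i := by rw [hww', one_smul]; abel
        rw [this]
        exact (hunit (v + w') i).trans (hhalf v _ hb)
      · -- backward step: base `v + w`
        have hb : nrm v / 2 ≤ nrm (v + w) := half_nrm_le_nrm_add v w hsup
        have : v + w' = (v + w) + e i := by rw [hww', neg_one_smul]; abel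
        rw [abs_sub_comm, this]
        exact (hunit (v + w) i).trans (hhalf v _ hb)
    calc |dG₀ μ (v + w) - dG₀ μ v| ≤ |dG₀ μ (v + w) - dG₀ μ (v + w')| + |dG₀ μ (v + w') - dG₀ μ v| := abs_sub_le _ _ _
      _ ≤ C₂ * 2 ^ d / nrm v ^ d + m * (C₂ * 2 ^ d / nrm v ^ d) := add_le_add h2 h1
      _ = ((m + 1 : ℕ) : ℝ) * (C₂ * 2 ^ d / nrm v ^ d) := by push_cast; ring

end

end Summit.QuantumFields.BalabanUV.T4Continuum.NE7FlatGradientModulusPrep
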